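import Literature.AnabelianGeometry.EtaleTheta.Discharge.Sec2Cor219iAtModelChi
import Literature.AnabelianGeometry.EtaleTheta.SettingModelGfpRigidity
import Literature.AnabelianGeometry.EtaleTheta.SettingModelTateDoubleUnderline
import Literature.AnabelianGeometry.EtaleTheta.SettingModelTateThetaOddShear
import HarnessLib

/-!
# [EtTh] Cor. 2.18 (i) (F-0620) AT THE STAGE-2 TATE MODEL `ThetaSetting.modelχq p i 2`:
# the `Π^tp_Ÿ`-clause for `Δ`-stabilising automorphisms over inner automorphisms of `G_{ℚ_p}`, and
# `Cor218_i` FROM the extension property + (HGAL) (proof-only; row «COR218I-AT-MODELTATE», K-L6)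

S. Mochizuki, *The étale theta function and its Frobenioid-theoretic manifestations* [EtTh], Publ. RIMS **45**
(2009): Cor. 2.18 (i), PRIMS PDF p. 60 [cite: MochizukiEtTh2009, Cor 2.18(i) p.60] (the named fact
`RigidData.Cor218_i`, FACT-LIST F-0620: invariance of `Π•_Y, Π•_Ÿ, Δ, (Π•_X)^Θ-kernel, l·Δ_Θ`-preimage and the
cusp labels under EVERY topological automorphism of `Π^tp_{X̲̲}`); Thm. 1.6 (i), p. 24 («`γ(Π^tp_{Ÿα}) = Π^tp_{Ÿβ}`»);
Prop. 2.4 (i), p. 38 («any automorphism of `Π^tp_{X̲̲}` induces automorphisms of `Π^tp_X`», [Mzk3] Thm. 2.4 K-coricity +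
[Mzk2] Lem. 1.3.8); [AbsTopIII] Cor. 1.10 ((HGAL)).

abc-iut cell, layer L6 / K-L6 instance column, seat abc-iut-L6-d6 (gen 5), row «COR218I-AT-MODELTATE»
(abc-iut-L6-lead §F v1.19bc (1), abc-iut-L2-lead R531). PROOF-ONLY: no definition, no instance, no `Prop`-valued
fact; nothing of another seat is edited or restated — every input is consumed BY NAME.

THE QUESTION (K-L6 instance record of [IUTchII] Def 1.1 → Cor 1.11 at the Tate model, abc-iut-w4-d030 p456925 /
w5-d233 p453435 / w4-d038 p454451 / f-153 p456036): the binder `h218i : ∀ M, (C.rigidData (τ.mod M) hC hS h15 L).Cor218_i`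
(L = the empty labelling) at `D := ThetaSetting.modelχq p 1 2` — decide it at the model, or reduce it.

WHAT THIS FILE PROVES (numbers, not adjectives).
§1 (X-level, `D = modelχq p i 2`, any `i`): for every topological automorphism `Γ` of `Π^tp_X = Γ ⋊_{actχq} G_{ℚ_p}`
with `Γ(Δ^tp_X) = Δ^tp_X` and lying over an INNER automorphism of `G_{ℚ_p}` (`∃ τ, aug (Γ g) = τ·aug g·τ⁻¹`):
**`Γ(Π^tp_Ÿ) = Π^tp_Ÿ`** (`map_GtpYdd_eq_of_map_deltaTemp_eq_of_inner_modelχq`). Ingredients: abc-iut-w5-d051's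
`map_dY_eq` (every topological automorphism of `Γ = F̂₂ ×_Ẑ ℤ` preserves each `Δ^tp_{Y_N}`), the max-compact clause
(compact subgroups of `Π^tp_X` lie in `Π^tp_Y`, abc-iut-L6-d6 gen 3), and ONE mod-2 Heisenberg computation: writing
`Γ(inr σ) = (c σ, σ)` (after the inner normalisation), the relation `Γ(σ·a) = c σ · (σ·Γ(a)) · (c σ)⁻¹` read in
`Heis(ℤ/2)` (where the Tate shear `a ↦ b^{κ_p} a b^{κ_p²·…}` acts as `Inn(b^{κ_p^i})` only: `χ₂ ≡ 1`, `κ_p² ≡ 0`) forces the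
`b`-exponent of `c σ` to be EVEN — i.e. `c σ ∈ Δ^tp_{Y_2}`.
§2 (X̲̲-level, the record's shape): for EVERY étale-theta datum `E` over `modelχq p i 2`, every `X̲̲`-choice
`C : E.DoubleUnderline l`, every level `μ`, `hC`, `hS`, `h15` and the EMPTY cusp labelling:
**`(C.rigidData μ hC hS h15 L∅).Cor218_i` FOLLOWS from `hextΔ` ∧ `hgal`** (`rigidData_cor218_i_modelχq_of_extends_of_hgal`), where
`hextΔ` := «every topological automorphism of `Π^tp_{X̲̲}` extends to a `Δ^tp_X`-stabilising topological automorphism of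
`Π^tp_X`» ([EtTh] Prop. 2.4 (i) / [Mzk3] Thm. 2.4 + [Mzk2] Lem. 1.3.8 shape — the residual abc-iut-f-148 named for
Cor. 2.19 (i) at the models, `Sec2Cor219iAtModelChi` §4) and `hgal` := «every topological automorphism of `Π^tp_{X̲̲}`
lies over an inner automorphism of `G_{ℚ_p}`» ([AbsTopIII] Cor. 1.10 shape = the record's (HGAL) binder). The three
`L`-free core clauses come from abc-iut-L2-d1's backbone `rigidData_cor218_i_of_extends` (via `rigidData_core_of_extends`),
the `Ÿ̲̲`-clause from §1, the label clause is trivial at `L∅`.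
K-L6 CONSEQUENCE (bookkeeping, BY NAME, not a verdict): on the Def1.1 → Cor1.11 @ modelTate tokens the residual
{F-0620, (H1) hΔ, (HGAL)} becomes {hextΔ, (HGAL)} ((H1) ⟸ hextΔ). F-0620@instance itself is NOT decided here: its `∀`
ranges over automorphisms of `Π^tp_{X̲̲}` that need not extend to `Π^tp_X` (the model has no analogue of K-coricity) —
see the seat's memo `HOME/staging/L6/L6-d6/g5/COR218I-AT-MODELTATE.md` for the census of constructible automorphisms
(all of which satisfy the six clauses).

HONEST LABEL: `modelχq` is a SEMI-SYNTHETIC model of the typed [EtTh] §1 interface (statement/model-pair evidence,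
not the tempered `π₁` of a curve); F-0620 stays a FACT-policy row; `hextΔ`, `hgal` are hypotheses BY NAME, not
endorsed; nothing of [EtTh] (refereed) is asserted beyond the tree's proofs; no side is taken on [IUTchIII] Cor. 3.12;
typed ≠ proved; nothing here says abc is proved or refuted.
-/

noncomputable section

namespace Literature.AnabelianGeometry.EtaleTheta

namespace SettingModel

open Literature.AnabelianGeometry.SemiGraphs Function Topology

variable (p : ℕ) [Fact p.Prime] (i : ℤ)

/-! ## §1. The `Π^tp_Ÿ`-clause at `modelχq p i 2` for `Δ`-stabilising automorphisms over inner automorphisms -/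

/-- At `q_X = p²`, `K_2 = ℚ_p(ζ_2, (p²)^{1/2}) = ℚ_p`: every `σ ∈ G_{ℚ_p}` lies in `G_{K_2}` (`χ_2 ≡ 1`, `κ_p² ≡ 0 (2)`).
[cite: MochizukiEtTh2009, §1 p.13] -/
theorem mem_fixingSubgroup_fieldKN_two (σ : GQp p) : σ ∈ (fieldKN ⊥ (qModel p) 2).fixingSubgroup :=
  (mem_GKNq_iff p σ 2).mpr ⟨levelChar_two_eq_one _, level_two_sq _⟩

/-- Membership in `Π^tp_Ÿ` of the stage-2 model: `g ∈ Π^tp_Ÿ ↔ g.left ∈ Δ^tp_{Y_2}` (`Π^tp_Ÿ = Π^tp_{Y_2} = Δ^tp_{Y_2} ⋊ G_{K_2}`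
with `G_{K_2} = G_{ℚ_p}`). [cite: MochizukiEtTh2009, §1 p.17] -/
theorem mem_GtpYdd_modelχq_iff (g : PiTpχq p i 2) :
    g ∈ (ThetaSetting.modelχq p i 2 even_two).GtpYdd ↔ g.left ∈ dY 2 := by
  rw [GtpYdd_modelχq]
  change g ∈ (tateTwistData₀ p i 2).YN 2 (fieldKN ⊥ (qModel p) 2).fixingSubgroup ↔ _
  rw [GfpTwistData₀.mem_YN]
  exact ⟨fun h => h.1, fun h => ⟨h, mem_fixingSubgroup_fieldKN_two p _⟩⟩

/-- **Compact subgroups die in `Z`**: the image of the compact `G_{ℚ_p}` under any topological automorphism `Γ` of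
`Π^tp_X` lies in `Π^tp_Y`, i.e. `(Γ (inr σ)).left` has degree `0`. [cite: MochizukiEtTh2009, §1 p.12] -/
theorem left_apply_inr_mem_ker_gfpSnd (Γ : PiTpχq p i 2 ≃ₜ* PiTpχq p i 2) (σ : GQp p) :
    (Γ (SemidirectProduct.inr σ)).left ∈ gfpSnd.ker := by
  haveI := compactSpace_GQp p
  have hK : IsCompact ((((⊤ : Subgroup (GQp p)).map
      (SemidirectProduct.inr : GQp p →* PiTpχq p i 2)).map Γ.toMulEquiv.toMonoidHom :
        Subgroup (PiTpχq p i 2)) : Set (PiTpχq p i 2)) := by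
    rw [Subgroup.coe_map, Subgroup.coe_map, Subgroup.coe_top]
    exact (isCompact_univ.image (continuous_inrχq p i 2)).image Γ.continuous
  have hle := (ThetaSetting.modelχq p i 2 even_two).le_GtpY_of_isCompact _ hK
  have hmem : Γ (SemidirectProduct.inr σ) ∈ (ThetaSetting.modelχq p i 2 even_two).GtpY :=
    hle ⟨SemidirectProduct.inr σ, ⟨σ, Subgroup.mem_top σ, rfl⟩, rfl⟩
  change Γ (SemidirectProduct.inr σ) ∈ ((tateTwistData₀ p i 2).toZ).ker at hmem
  rw [MonoidHom.mem_ker, GfpTwistData₀.toZ_apply] at hmem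
  exact hmem

/-- The left projection `Π^tp_X → Γ`, `g ↦ g.left`, is continuous (induced topology). [folklore] -/
private theorem continuous_left_PiTpχq_two : Continuous fun g : PiTpχq p i 2 => g.left :=
  continuous_fst.comp (continuous_leftRightχq p i 2)

/-- If `Γ` stabilises `Δ^tp_X`, so does `Γ⁻¹`. [folklore] -/
private theorem map_deltaTempχq_symm_eq_of_map_eq (Γ : PiTpχq p i 2 ≃ₜ* PiTpχq p i 2)
    (hΔ : (curveχq p i 2).DeltaTemp.map Γ.toMulEquiv.toMonoidHom = (curveχq p i 2).DeltaTemp) :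
    (curveχq p i 2).DeltaTemp.map Γ.symm.toMulEquiv.toMonoidHom = (curveχq p i 2).DeltaTemp := by
  refine le_antisymm ?_ ?_
  · rintro _ ⟨x, hx, rfl⟩
    have hx2 : x ∈ (curveχq p i 2).DeltaTemp.map Γ.toMulEquiv.toMonoidHom := by rw [hΔ]; exact hx
    obtain ⟨y, hy, rfl⟩ := hx2
    change Γ.symm (Γ y) ∈ _
    rw [Γ.symm_apply_apply]; exact hy
  · intro x hx
    refine ⟨Γ x, ?_, Γ.symm_apply_apply x⟩
    rw [← hΔ]; exact ⟨x, hx, rfl⟩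

/-- If `Γ` stabilises `Δ^tp_X` then `Γ(inl q) ∈ Δ^tp_X`, i.e. `(Γ (inl q)).right = 1`. [folklore] -/
private theorem right_apply_inl_eq_one_of_map_deltaTempχq_eq (Γ : PiTpχq p i 2 ≃ₜ* PiTpχq p i 2)
    (hΔ : (curveχq p i 2).DeltaTemp.map Γ.toMulEquiv.toMonoidHom = (curveχq p i 2).DeltaTemp) (q : Gfp) :
    (Γ (SemidirectProduct.inl q)).right = 1 := by
  have hmem : Γ (SemidirectProduct.inl q) ∈ (curveχq p i 2).DeltaTemp := by
    rw [← hΔ]; exact ⟨SemidirectProduct.inl q, inl_mem_deltaTempχq p i 2 q, rfl⟩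
  exact (mem_deltaTempχq_iff p i 2 _).mp hmem

/-- A `Δ^tp_X`-stabilising topological automorphism of `Π^tp_X = Γ ⋊ G_{ℚ_p}` restricts to a topological automorphism
`φ` of `Γ` with `Γ(inl q) = inl (φ q)`. [cite: MochizukiEtTh2009, §1 p.12] -/
theorem exists_restrict_of_map_deltaTemp_eq (Γ : PiTpχq p i 2 ≃ₜ* PiTpχq p i 2)
    (hΔ : (curveχq p i 2).DeltaTemp.map Γ.toMulEquiv.toMonoidHom = (curveχq p i 2).DeltaTemp) :
    ∃ φ : Gfp ≃ₜ* Gfp, ∀ q : Gfp, Γ (SemidirectProduct.inl q) = SemidirectProduct.inl (φ q) := by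
  have hr : ∀ q : Gfp, (Γ (SemidirectProduct.inl q)).right = 1 := right_apply_inl_eq_one_of_map_deltaTempχq_eq p i Γ hΔ
  have hr' : ∀ q : Gfp, (Γ.symm (SemidirectProduct.inl q)).right = 1 :=
    right_apply_inl_eq_one_of_map_deltaTempχq_eq p i Γ.symm (map_deltaTempχq_symm_eq_of_map_eq p i Γ hΔ)
  have hinl : ∀ q : Gfp, Γ (SemidirectProduct.inl q) = SemidirectProduct.inl (Γ (SemidirectProduct.inl q)).left :=
    fun q => by ext <;> simp [hr q]
  have hinl' : ∀ q : Gfp,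
      Γ.symm (SemidirectProduct.inl q) = SemidirectProduct.inl (Γ.symm (SemidirectProduct.inl q)).left :=
    fun q => by ext <;> simp [hr' q]
  refine ⟨{ toFun := fun q => (Γ (SemidirectProduct.inl q)).left
            invFun := fun q => (Γ.symm (SemidirectProduct.inl q)).left
            left_inv := fun q => ?_
            right_inv := fun q => ?_
            map_mul' := fun a b => ?_
            continuous_toFun := (continuous_left_PiTpχq_two p i).comp (Γ.continuous.comp (continuous_inlχq p i 2))
            continuous_invFun := (continuous_left_PiTpχq_two p i).comp (Γ.symm.continuous.comp (continuous_inlχq p i 2)) },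
    fun q => hinl q⟩
  · change (Γ.symm (SemidirectProduct.inl (Γ (SemidirectProduct.inl q)).left)).left = q
    rw [← hinl q, Γ.symm_apply_apply, SemidirectProduct.left_inl]
  · change (Γ (SemidirectProduct.inl (Γ.symm (SemidirectProduct.inl q)).left)).left = q
    rw [← hinl' q, Γ.apply_symm_apply, SemidirectProduct.left_inl]
  · have h := congrArg SemidirectProduct.left
      (show Γ (SemidirectProduct.inl (a * b)) = Γ (SemidirectProduct.inl a) * Γ (SemidirectProduct.inl b) by
        rw [← map_mul, ← map_mul])
    rw [h, hinl a, hinl b, ← map_mul, SemidirectProduct.left_inl, SemidirectProduct.left_inl,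
      SemidirectProduct.left_inl]

/-- **A topological automorphism of `Γ` maps the degree-`1` generator to an element of ODD degree** (it induces
`±1` on `Γ/Δ^tp_Y ≅ ℤ`): the `x`-coordinate of `ĥ_2` of `φ(a)` is `1`. [cite: MochizukiEtTh2009, §1 p.12] -/
theorem levelHom_two_x_apply_gfpOf_zero (φ : Gfp ≃ₜ* Gfp) :
    (levelHom 2 (φ (gfpOf (FreeGroup.of 0)))).x = 1 := by
  set qa : Gfp := gfpOf (FreeGroup.of 0) with hqa
  have hqa1 : gfpSnd qa = Multiplicative.ofAdd 1 := by
    rw [hqa, gfpSnd_gfpOf, expA_apply, heisHom_of_zero]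
  set d : ℤ := Multiplicative.toAdd (gfpSnd (φ qa)) with hd
  -- `deg (φ q) = deg q · d` for every `q`
  have hmul : ∀ q : Gfp, Multiplicative.toAdd (gfpSnd (φ q)) = Multiplicative.toAdd (gfpSnd q) * d := by
    intro q
    set n : ℤ := Multiplicative.toAdd (gfpSnd q) with hn
    have hk : q * (qa ^ n)⁻¹ ∈ gfpSnd.ker := by
      rw [MonoidHom.mem_ker, map_mul, map_inv, map_zpow, hqa1]
      apply Multiplicative.toAdd.injective
      rw [toAdd_mul, toAdd_inv, toAdd_zpow, toAdd_ofAdd, smul_eq_mul, mul_one, toAdd_one, ← hn, add_neg_cancel]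
    have hk' : φ (q * (qa ^ n)⁻¹) ∈ gfpSnd.ker := (apply_mem_ker_gfpSnd_iff φ _).mpr hk
    rw [MonoidHom.mem_ker, map_mul, map_inv, map_zpow, map_mul, map_inv, map_zpow] at hk'
    have := congrArg Multiplicative.toAdd hk'
    rw [toAdd_mul, toAdd_inv, toAdd_zpow, toAdd_one, smul_eq_mul] at this
    linarith
  -- `φ` is onto `qa`, so `d ∣ 1`
  obtain ⟨q, hq⟩ := φ.surjective qa
  have h1 : Multiplicative.toAdd (gfpSnd q) * d = 1 := by
    rw [← hmul q, hq, hqa1, toAdd_ofAdd]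
  have hd1 : d = 1 ∨ d = -1 := Int.eq_one_or_neg_one_of_mul_eq_one ((mul_comm _ _).trans h1)
  rw [levelHom_x_eq_cast, ← hd]
  rcases hd1 with h | h <;> rw [h] <;> decide

/-- Conjugation by a fixed element of `Π^tp_X`, as a topological automorphism. [folklore] -/
private theorem exists_conj_continuousMulEquiv_PiTpχq (h : PiTpχq p i 2) :
    ∃ κ : PiTpχq p i 2 ≃ₜ* PiTpχq p i 2, ∀ g, κ g = h * g * h⁻¹ :=
  ⟨{ MulAut.conj h with
      continuous_toFun := (continuous_const.mul continuous_id).mul continuous_const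
      continuous_invFun := (continuous_const.mul continuous_id).mul continuous_const }, fun _ => rfl⟩

/-- Every square in `Heis(ℤ/2)` of an element with `x = 0` is trivial. [folklore] -/
private theorem heis_two_sq_eq_one_of_x_eq_zero (Q : Heis (ZMod ((2 : ℕ+) : ℕ))) (hQ : Q.x = 0) : Q ^ 2 = 1 := by
  rw [Heis.pow_eq_of_x_eq_zero Q hQ 2]
  have h2 : ((2 : ℕ) : ZMod ((2 : ℕ+) : ℕ)) = 0 := by decide
  rw [h2, zero_mul, zero_mul]
  rfl

/-- A unit of `ℤ/2` is `1`. [folklore] -/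
private theorem zmod_two_eq_one_of_isUnit {c : ZMod ((2 : ℕ+) : ℕ)} (hc : IsUnit c) : c = 1 := by
  have hne : c ≠ 0 := hc.ne_zero
  clear hc
  revert hne; revert c
  change ∀ c : ZMod 2, c ≠ 0 → c = 1
  decide

/-- The mod-`2` arithmetic of the Heisenberg relation: the `y`-coordinate of the cocycle value vanishes. [folklore] -/
private theorem heis_two_y_eq_zero (P₁ A Lc : Heis (ZMod ((2 : ℕ+) : ℕ))) (t : ZMod ((2 : ℕ+) : ℕ))
    (hP₁x : P₁.x = 0) (hP₁y : P₁.y = t) (hAx : A.x = 1) (hLcx : Lc.x = 0)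
    (hE : P₁ * A * P₁⁻¹ =
      Lc * ((⟨0, t, 0⟩ : Heis (ZMod ((2 : ℕ+) : ℕ))) * A * (⟨0, t, 0⟩ : Heis (ZMod ((2 : ℕ+) : ℕ)))⁻¹) * Lc⁻¹) :
    Lc.y = 0 := by
  have hz := congrArg Heis.z hE
  simp only [Heis.mul_z, Heis.mul_x, Heis.mul_y, Heis.inv_x, Heis.inv_y, Heis.inv_z, hP₁x, hP₁y, hAx, hLcx] at hz
  linear_combination hz

/-- **The mod-2 Heisenberg computation (core of §1).** Let `Γ` be a topological automorphism of `Π^tp_X` lying over the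
IDENTITY of `G_{ℚ_p}` and restricting to `φ` on `Γ`; write `Γ(inr σ) = (c σ, σ)`. Then `c σ ∈ Δ^tp_{Y_2}`: its degree is `0`
(compactness) and its `b`-exponent is EVEN — from the relation `φ(σ·a) = c σ · (σ·φ(a)) · (c σ)⁻¹` read in `Heis(ℤ/2)`,
where the stage-2 action is `Inn(b^{κ_p^i})` only (`χ ≡ 1`, shear by `κ_p² ≡ 0 (mod 2)`) and `φ(a)` has odd degree.
[cite: MochizukiEtTh2009, Thm 1.6 (i) p.24] -/
theorem left_apply_inr_mem_dY_two (Γ : PiTpχq p i 2 ≃ₜ* PiTpχq p i 2) (φ : Gfp ≃ₜ* Gfp)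
    (hφ : ∀ q : Gfp, Γ (SemidirectProduct.inl q) = SemidirectProduct.inl (φ q))
    (hid : ∀ g : PiTpχq p i 2, (Γ g).right = g.right) (σ : GQp p) :
    (Γ (SemidirectProduct.inr σ)).left ∈ dY 2 := by
  set c : Gfp := (Γ (SemidirectProduct.inr σ)).left with hc
  have hcdeg : c ∈ gfpSnd.ker := left_apply_inr_mem_ker_gfpSnd p i Γ σ
  refine Subgroup.mem_inf.mpr ⟨hcdeg, Subgroup.mem_comap.mpr ⟨levelHom_x_eq_zero hcdeg, ?_⟩⟩
  change (levelHom 2 c).y = 0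
  -- notation
  set qa : Gfp := gfpOf (FreeGroup.of 0) with hqa
  set T : ZH := kappaP p σ ^ i with hT
  set S : ZH := kappaP p σ ^ (2 : ℤ) with hS
  have hS2 : ZHatLevel.level 2 S = 1 := by
    rw [hS, show ((2 : ℤ)) = ((2 : ℕ) : ℤ) from rfl, zpow_natCast]; exact level_two_sq _
  -- `Γ (inr σ) = inl c * inr σ`
  have hΓσ : Γ (SemidirectProduct.inr σ) = SemidirectProduct.inl c * SemidirectProduct.inr σ := by
    conv_lhs => rw [← SemidirectProduct.inl_left_mul_inr_right (Γ (SemidirectProduct.inr σ))]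
    rw [hid, SemidirectProduct.right_inr]
  -- the relation `φ (σ·qa) = c · σ·(φ qa) · c⁻¹` in `Γ`
  have hE : φ (actχq p i 2 σ qa) = c * actχq p i 2 σ (φ qa) * c⁻¹ := by
    refine (SemidirectProduct.inl_injective (φ := actχq p i 2)) ?_
    calc (SemidirectProduct.inl (φ (actχq p i 2 σ qa)) : PiTpχq p i 2)
        = Γ (SemidirectProduct.inl (actχq p i 2 σ qa)) := (hφ _).symm
      _ = Γ (SemidirectProduct.inr σ * SemidirectProduct.inl qa * SemidirectProduct.inr σ⁻¹) := by
          rw [← SemidirectProduct.inl_aut]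
      _ = Γ (SemidirectProduct.inr σ) * SemidirectProduct.inl (φ qa) * (Γ (SemidirectProduct.inr σ))⁻¹ := by
          rw [map_mul, map_mul, hφ, map_inv, map_inv]
      _ = SemidirectProduct.inl c * (SemidirectProduct.inr σ * SemidirectProduct.inl (φ qa) *
            SemidirectProduct.inr σ⁻¹) * (SemidirectProduct.inl c)⁻¹ := by
          rw [hΓσ, mul_inv_rev, ← map_inv]; simp only [mul_assoc]
      _ = SemidirectProduct.inl c * SemidirectProduct.inl (actχq p i 2 σ (φ qa)) * (SemidirectProduct.inl c)⁻¹ := by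
          rw [← SemidirectProduct.inl_aut]
      _ = SemidirectProduct.inl (c * actχq p i 2 σ (φ qa) * c⁻¹) := by rw [map_mul, map_mul, map_inv]
  -- extend `φ` along the profinite completion `pr₁ : Γ → F̂₂`
  obtain ⟨Φ, hΦ⟩ := isProfiniteCompletion_gfpFst.exists_extension
    (⟨gfpFst.toMonoidHom.comp φ.toMulEquiv.toMonoidHom, gfpFst.continuous.comp φ.continuous⟩ : Gfp →ₜ* F₂hatT)
  have hΦ' : ∀ q : Gfp, Φ (gfpFst q) = gfpFst (φ q) := fun q => hΦ q
  obtain ⟨hker, hb⟩ := extension_spec φ hΦ'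
  -- the pieces in `Heis(ℤ/2)`
  have hB : hHat 2 (bPow T) = ⟨0, Multiplicative.toAdd (ZHatLevel.level 2 T), 0⟩ := hHat_bPow 2 T
  set t : ZMod ((2 : ℕ+) : ℕ) := Multiplicative.toAdd (ZHatLevel.level 2 T) with ht
  set P₁ : Heis (ZMod ((2 : ℕ+) : ℕ)) := hHat 2 (Φ (bPow T)) with hP₁
  set A : Heis (ZMod ((2 : ℕ+) : ℕ)) := levelHom 2 (φ qa) with hA
  have hP₁x : P₁.x = 0 := hHat_x_eq_zero_of_eHat_eq_one 2 (hker _ (eHat_bPow T))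
  have hc₂ : (hHat 2 (Φ (eta (FreeGroup.of 1)))).y = 1 := zmod_two_eq_one_of_isUnit (isUnit_coeff_of_exists Φ 2 hb)
  have hP₁y : P₁.y = t := by
    rw [hP₁, hHat_y_apply_eq_of_eHat_eq_one Φ 2 (eHat_bPow T), hc₂, one_mul, hB]
  have hP₂ : hHat 2 (Φ (bPow S)) = 1 := by
    have hSq : bPow S = bPow (kappaP p σ) ^ 2 := by
      rw [hS, show ((2 : ℤ)) = ((2 : ℕ) : ℤ) from rfl, zpow_natCast, map_pow]
    rw [hSq, map_pow, map_pow]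
    exact heis_two_sq_eq_one_of_x_eq_zero _ (hHat_x_eq_zero_of_eHat_eq_one 2 (hker _ (eHat_bPow _)))
  have hAx : A.x = 1 := levelHom_two_x_apply_gfpOf_zero φ
  have hLcx : (levelHom 2 c).x = 0 := levelHom_x_eq_zero hcdeg
  -- the stage-2 action on `ĥ_2`: `Inn(ĥ_2 b^T)` only
  have hact : ∀ X : F₂hatT, hHat 2 (actHatχq p i 2 σ X) = hHat 2 (bPow T) * hHat 2 X * (hHat 2 (bPow T))⁻¹ := by
    intro X
    rw [actHatχq_apply, affTwist₃_apply]
    change hHat 2 (innB T (shear S (twist (chi p σ) X))) = _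
    rw [innB_apply, map_mul, map_mul, map_inv, hHat_shear_of_level_eq_one 2 hS2, hHat_twist, levelChar_two_eq_one,
      Heis.diagTwist_apply, one_mul, one_mul]
  -- LHS of the relation in `Heis(ℤ/2)`
  have hL : levelHom 2 (φ (actχq p i 2 σ qa)) = P₁ * A * P₁⁻¹ := by
    change hHat 2 (gfpFst (φ (actχq p i 2 σ qa))) = _
    rw [← hΦ', gfpFst_actχq, actHatχq_apply, affTwist₃_apply]
    change hHat 2 (Φ (innB T (shear S (twist (chi p σ) (gfpFst qa))))) = _
    have hqa1 : gfpFst qa = eta (FreeGroup.of 0) := rfl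
    rw [hqa1, twist_eta_of_zero, shear_eta_of_zero, innB_apply, map_mul, map_mul, map_mul, map_inv,
      map_mul, map_mul, map_mul, map_inv, hP₂, mul_one, hA]
    change _ = P₁ * hHat 2 (gfpFst (φ qa)) * P₁⁻¹
    rw [← hΦ' qa, hqa1]
  -- RHS of the relation in `Heis(ℤ/2)`
  have hR : levelHom 2 (c * actχq p i 2 σ (φ qa) * c⁻¹) =
      levelHom 2 c * (hHat 2 (bPow T) * A * (hHat 2 (bPow T))⁻¹) * (levelHom 2 c)⁻¹ := by
    rw [map_mul, map_mul, map_inv]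
    congr 2
    change hHat 2 (gfpFst (actχq p i 2 σ (φ qa))) = _
    rw [gfpFst_actχq, hact]
    rfl
  have hEq : P₁ * A * P₁⁻¹ = levelHom 2 c *
      ((⟨0, t, 0⟩ : Heis (ZMod ((2 : ℕ+) : ℕ))) * A * (⟨0, t, 0⟩ : Heis (ZMod ((2 : ℕ+) : ℕ)))⁻¹) *
        (levelHom 2 c)⁻¹ := by
    rw [← hL, hE, hR, hB]
  exact heis_two_y_eq_zero P₁ A (levelHom 2 c) t hP₁x hP₁y hAx hLcx hEq

/-- `Π^tp_Ÿ` is stable under a `Δ`-stabilising topological automorphism of `Π^tp_X` over the identity of `G_{ℚ_p}`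
(one inclusion). [cite: MochizukiEtTh2009, Thm 1.6 (i) p.24] -/
theorem apply_mem_GtpYdd_of_right_eq (Γ : PiTpχq p i 2 ≃ₜ* PiTpχq p i 2)
    (hΔ : (curveχq p i 2).DeltaTemp.map Γ.toMulEquiv.toMonoidHom = (curveχq p i 2).DeltaTemp)
    (hid : ∀ g : PiTpχq p i 2, (Γ g).right = g.right) {g : PiTpχq p i 2}
    (hg : g ∈ (ThetaSetting.modelχq p i 2 even_two).GtpYdd) : Γ g ∈ (ThetaSetting.modelχq p i 2 even_two).GtpYdd := by
  obtain ⟨φ, hφ⟩ := exists_restrict_of_map_deltaTemp_eq p i Γ hΔ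
  rw [mem_GtpYdd_modelχq_iff] at hg ⊢
  have hdec : Γ g = SemidirectProduct.inl (φ g.left) * Γ (SemidirectProduct.inr g.right) := by
    conv_lhs => rw [← SemidirectProduct.inl_left_mul_inr_right g]
    rw [map_mul, hφ]
  rw [hdec, SemidirectProduct.mul_left, SemidirectProduct.left_inl, SemidirectProduct.right_inl, map_one,
    MulAut.one_apply]
  exact (dY 2).mul_mem ((apply_mem_dY_iff φ 2 _).mpr hg) (left_apply_inr_mem_dY_two p i Γ φ hφ hid g.right)

/-- **§1, identity case.** A `Δ^tp_X`-stabilising topological automorphism of `Π^tp_X(modelχq p i 2)` over the identity of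
`G_{ℚ_p}` maps `Π^tp_Ÿ` ONTO itself. [cite: MochizukiEtTh2009, Thm 1.6 (i) p.24] -/
theorem map_GtpYdd_eq_of_map_deltaTemp_eq_of_right_eq (Γ : PiTpχq p i 2 ≃ₜ* PiTpχq p i 2)
    (hΔ : (curveχq p i 2).DeltaTemp.map Γ.toMulEquiv.toMonoidHom = (curveχq p i 2).DeltaTemp)
    (hid : ∀ g : PiTpχq p i 2, (Γ g).right = g.right) :
    (ThetaSetting.modelχq p i 2 even_two).GtpYdd.map Γ.toMulEquiv.toMonoidHom =
      (ThetaSetting.modelχq p i 2 even_two).GtpYdd := by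
  have hid' : ∀ g : PiTpχq p i 2, (Γ.symm g).right = g.right := fun g => by
    conv_rhs => rw [← Γ.apply_symm_apply g]
    rw [hid]
  refine le_antisymm ?_ ?_
  · rintro _ ⟨g, hg, rfl⟩
    exact apply_mem_GtpYdd_of_right_eq p i Γ hΔ hid hg
  · intro g hg
    exact ⟨Γ.symm g, apply_mem_GtpYdd_of_right_eq p i Γ.symm (map_deltaTempχq_symm_eq_of_map_eq p i Γ hΔ) hid' hg,
      Γ.apply_symm_apply g⟩

/-- **§1. A `Δ^tp_X`-stabilising topological automorphism of `Π^tp_X(modelχq p i 2)` lying over an INNER automorphism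
of `G_{ℚ_p}` maps `Π^tp_Ÿ` ONTO itself** (reduce to the identity case by the inner automorphism `Inn(inr τ⁻¹)`, under which
`Δ^tp_X` and `Π^tp_Ÿ` are normal). [cite: MochizukiEtTh2009, Thm 1.6 (i) p.24] -/
theorem map_GtpYdd_eq_of_map_deltaTemp_eq_of_inner_modelχq (Γ : PiTpχq p i 2 ≃ₜ* PiTpχq p i 2)
    (hΔ : (curveχq p i 2).DeltaTemp.map Γ.toMulEquiv.toMonoidHom = (curveχq p i 2).DeltaTemp)
    (hinn : ∃ τ : GQp p, ∀ g : PiTpχq p i 2, (Γ g).right = τ * g.right * τ⁻¹) :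
    (ThetaSetting.modelχq p i 2 even_two).GtpYdd.map Γ.toMulEquiv.toMonoidHom =
      (ThetaSetting.modelχq p i 2 even_two).GtpYdd := by
  obtain ⟨τ, hτ⟩ := hinn
  obtain ⟨κ, hκ⟩ := exists_conj_continuousMulEquiv_PiTpχq p i (SemidirectProduct.inr τ⁻¹ : PiTpχq p i 2)
  -- `Γ' := κ ∘ Γ` lies over the identity and still stabilises `Δ`
  let Γ' : PiTpχq p i 2 ≃ₜ* PiTpχq p i 2 := Γ.trans κ
  have hΓ' : ∀ g, Γ' g = SemidirectProduct.inr τ⁻¹ * Γ g * (SemidirectProduct.inr τ⁻¹)⁻¹ := fun g => hκ (Γ g)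
  have hid : ∀ g : PiTpχq p i 2, (Γ' g).right = g.right := fun g => by
    rw [hΓ', SemidirectProduct.mul_right, SemidirectProduct.mul_right, SemidirectProduct.inv_right,
      SemidirectProduct.right_inr, hτ]
    group
  have hΔ' : (curveχq p i 2).DeltaTemp.map Γ'.toMulEquiv.toMonoidHom = (curveχq p i 2).DeltaTemp := by
    have hright : ∀ g : PiTpχq p i 2, (Γ' g).right = 1 ↔ (Γ g).right = 1 := fun g => by
      rw [hΓ', SemidirectProduct.mul_right, SemidirectProduct.mul_right, SemidirectProduct.inv_right,
        SemidirectProduct.right_inr]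
      constructor
      · intro h
        have e : (Γ g).right = τ⁻¹⁻¹ * (τ⁻¹ * (Γ g).right * τ⁻¹⁻¹) * τ⁻¹ := by group
        rw [e, h]; group
      · intro h; rw [h]; group
    refine le_antisymm ?_ ?_
    · rintro _ ⟨g, hg, rfl⟩
      have hΓg : Γ g ∈ (curveχq p i 2).DeltaTemp := by rw [← hΔ]; exact ⟨g, hg, rfl⟩
      exact (mem_deltaTempχq_iff p i 2 _).mpr ((hright g).mpr ((mem_deltaTempχq_iff p i 2 _).mp hΓg))
    · intro x hx
      refine ⟨Γ'.symm x, ?_, Γ'.apply_symm_apply x⟩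
      have h1 : (Γ' (Γ'.symm x)).right = 1 := by rw [Γ'.apply_symm_apply]; exact (mem_deltaTempχq_iff p i 2 _).mp hx
      have h2 : (Γ (Γ'.symm x)).right = 1 := (hright _).mp h1
      have h3 : Γ (Γ'.symm x) ∈ (curveχq p i 2).DeltaTemp.map Γ.toMulEquiv.toMonoidHom := by
        rw [hΔ]; exact (mem_deltaTempχq_iff p i 2 _).mpr h2
      obtain ⟨y, hy, hyx⟩ := h3
      have : y = Γ'.symm x := Γ.injective hyx
      rw [← this]; exact hy
  have hY' := map_GtpYdd_eq_of_map_deltaTemp_eq_of_right_eq p i Γ' hΔ' hid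
  -- transport back along the inner automorphism (`Π^tp_Ÿ` is normal)
  haveI := (ThetaSetting.modelχq_sec2Hyps p i 2 even_two).compat.GtpYdd_normal
  have hconj : ∀ g : PiTpχq p i 2, Γ g ∈ (ThetaSetting.modelχq p i 2 even_two).GtpYdd ↔
      Γ' g ∈ (ThetaSetting.modelχq p i 2 even_two).GtpYdd := fun g => by
    rw [hΓ']
    constructor
    · intro h; exact Subgroup.Normal.conj_mem inferInstance _ h _
    · intro h
      have := Subgroup.Normal.conj_mem inferInstance _ h (SemidirectProduct.inr τ⁻¹)⁻¹
      simpa [mul_assoc] using this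
  refine le_antisymm ?_ ?_
  · rintro _ ⟨g, hg, rfl⟩
    have : Γ' g ∈ (ThetaSetting.modelχq p i 2 even_two).GtpYdd := by rw [← hY']; exact ⟨g, hg, rfl⟩
    exact (hconj g).mpr this
  · intro x hx
    refine ⟨Γ.symm x, ?_, Γ.apply_symm_apply x⟩
    have h1 : Γ' (Γ.symm x) ∈ (ThetaSetting.modelχq p i 2 even_two).GtpYdd := (hconj _).mp (by rw [Γ.apply_symm_apply]; exact hx)
    have h2 : Γ' (Γ.symm x) ∈ (ThetaSetting.modelχq p i 2 even_two).GtpYdd.map Γ'.toMulEquiv.toMonoidHom := by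
      rw [hY']; exact h1
    obtain ⟨y, hy, hyx⟩ := h2
    have : y = Γ.symm x := Γ'.injective hyx
    rw [← this]; exact hy

/-! ## §2. F-0620 `Cor218_i` at the record's shape FROM the extension property + (HGAL) -/

/-- **F-0620 `Cor218_i` at `modelχq p i 2` (⊇ the Tate model `modelχq p 1 2`), for every étale-theta datum `E`, every
`X̲̲`-choice `C`, every level `μ`, `hC`, `hS`, `h15`, and the EMPTY cusp labelling, FROM: `hextΔ` — every topological
automorphism of `Π^tp_{X̲̲}` extends to a `Δ^tp_X`-stabilising topological automorphism of `Π^tp_X` ([EtTh] Prop. 2.4 (i) +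
[AbsAnab] Lem. 1.3.8 shape; abc-iut-f-148's named residual at the models) — and `hgal` — every topological automorphism of
`Π^tp_{X̲̲}` lies over an inner automorphism of `G_{ℚ_p}` ([AbsTopIII] Cor. 1.10 shape, the record's (HGAL)).** The three `L`-free
core clauses are abc-iut-L2-d1's `rigidData_cor218_i_of_extends`; the `Ÿ̲̲`-clause is §1; labels are empty.
CONDITIONAL-AT-MODEL: F-0620@instance is NOT decided. [cite: MochizukiEtTh2009, Cor 2.18(i) p.60] -/
theorem rigidData_cor218_i_modelχq_of_extends_of_hgal
    {E : (ThetaSetting.modelχq p i 2 even_two).EtaleThetaData} {l : ℕ} (C : E.DoubleUnderline l) {N : ℕ+}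
    (μ : (ThetaSetting.modelχq p i 2 even_two).CyclotomeMod l N) (hC : (ThetaSetting.modelχq p i 2 even_two).Compat)
    (hS : (ThetaSetting.modelχq p i 2 even_two).Sec2Hyps) (h15 : ThetaSetting.Prop15iii E hC)
    (hext : ∀ γ : ↥C.Huu ≃ₜ* ↥C.Huu, ∃ Γ : PiTpχq p i 2 ≃ₜ* PiTpχq p i 2,
      (∀ h : C.Huu, Γ (h : PiTpχq p i 2) = ((γ h : C.Huu) : PiTpχq p i 2)) ∧
        (curveχq p i 2).DeltaTemp.map Γ.toMulEquiv.toMonoidHom = (curveχq p i 2).DeltaTemp)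
    (hgal : ∀ γ : ↥C.Huu ≃ₜ* ↥C.Huu, ∃ τ : GQp p, ∀ h : C.Huu,
      (((γ h : C.Huu) : PiTpχq p i 2)).right = τ * (h : PiTpχq p i 2).right * τ⁻¹) :
    (C.rigidData μ hC hS h15 ⟨fun _ => ∅, fun _ => ∅, fun _ => rfl⟩).Cor218_i := by
  refine C.rigidData_cor218_i_of_extends μ hC hS h15 _ (fun γ => ?_) (fun γ a => Set.image_empty _)
  obtain ⟨Γ, hΓ, hΔ⟩ := hext γ
  obtain ⟨τ, hτ⟩ := hgal γ
  refine ⟨Γ, hΓ, hΔ, map_GtpYdd_eq_of_map_deltaTemp_eq_of_inner_modelχq p i Γ hΔ ⟨τ, fun g => ?_⟩⟩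
  -- `Γ` lies over `Inn τ` on ALL of `Π^tp_X`: pick `h ∈ Π^tp_{X̲̲}` over `g.right` (`Π^tp_{X̲̲} ↠ G_K = G_{ℚ_p}`)
  have hsurj : g.right ∈ C.Huu.map (ThetaSetting.modelχq p i 2 even_two).aug.toMonoidHom := by
    rw [C.map_aug_Huu, GK_modelχq p i 2]; exact Subgroup.mem_top _
  obtain ⟨h, hh, hhg⟩ := hsurj
  have hhg' : h.right = g.right := hhg
  have hd : (Γ (g * h⁻¹)).right = 1 := by
    refine right_apply_inl_eq_one_of_map_deltaTempχq_eq p i Γ hΔ (g * h⁻¹).left ▸ ?_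
    have : g * h⁻¹ = SemidirectProduct.inl (g * h⁻¹).left :=
      SemidirectProduct.ext (by rw [SemidirectProduct.left_inl])
        (by rw [SemidirectProduct.right_inl, SemidirectProduct.mul_right, SemidirectProduct.inv_right, hhg',
          mul_inv_cancel])
    rw [← this]
  have hsplit : Γ g = Γ (g * h⁻¹) * Γ h := by rw [← map_mul, inv_mul_cancel_right]
  rw [hsplit, SemidirectProduct.mul_right, hd, one_mul]
  have := hτ ⟨h, hh⟩
  rw [hhg'] at this
  exact (congrArg SemidirectProduct.right (hΓ ⟨h, hh⟩)).trans this

/-! ## §3 (appended v2). (H1) at the record's shape FROM the extension property: `hextΔ ⇒ hΔX` -/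

/-- **(H1) ⟸ hextΔ**: if every topological automorphism of `Π^tp_{X̲̲}` extends to a `Δ^tp_X`-stabilising topological automorphism of
`Π^tp_X`, then every topological automorphism of `Π^tp_{X̲̲}` maps `Δ_{X̲̲} = Δ^tp_X ∩ Π^tp_{X̲̲}` (read inside `Π^tp_{X̲̲}`) ONTO itself —
the record's (H1)/hΔX binder ([AbsAnab] Lem. 1.3.8 shape) is implied by `hextΔ`, so the K-L6 residual {F-0620, (H1), (HGAL)} of the
Def 1.1 → Cor 1.11 instance record at the Tate model is {hextΔ, (HGAL)} in kernel (with `rigidData_cor218_i_modelχq_of_extends_of_hgal`).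
Valid for every `X̲̲`-choice `C` over `modelχq p i 2`. [cite: MochizukiEtTh2009, Prop 2.4 p.38] -/
theorem map_deltaTemp_subgroupOf_Huu_eq_of_extends
    {E : (ThetaSetting.modelχq p i 2 even_two).EtaleThetaData} {l : ℕ} (C : E.DoubleUnderline l)
    (hext : ∀ γ : ↥C.Huu ≃ₜ* ↥C.Huu, ∃ Γ : PiTpχq p i 2 ≃ₜ* PiTpχq p i 2,
      (∀ h : C.Huu, Γ (h : PiTpχq p i 2) = ((γ h : C.Huu) : PiTpχq p i 2)) ∧
        (curveχq p i 2).DeltaTemp.map Γ.toMulEquiv.toMonoidHom = (curveχq p i 2).DeltaTemp)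
    (γ : ↥C.Huu ≃ₜ* ↥C.Huu) :
    ((curveχq p i 2).DeltaTemp.subgroupOf C.Huu).map γ.toMulEquiv.toMonoidHom =
      (curveχq p i 2).DeltaTemp.subgroupOf C.Huu := by
  -- one inclusion for every `γ` (from its extension), then apply it to `γ` and `γ⁻¹`
  have key : ∀ γ : ↥C.Huu ≃ₜ* ↥C.Huu, ∀ h : C.Huu, h ∈ (curveχq p i 2).DeltaTemp.subgroupOf C.Huu →
      γ h ∈ (curveχq p i 2).DeltaTemp.subgroupOf C.Huu := by
    intro γ h hh
    obtain ⟨Γ, hΓ, hΔ⟩ := hext γ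
    rw [Subgroup.mem_subgroupOf] at hh ⊢
    have : Γ (h : PiTpχq p i 2) ∈ (curveχq p i 2).DeltaTemp := by rw [← hΔ]; exact ⟨(h : PiTpχq p i 2), hh, rfl⟩
    rw [hΓ h] at this
    exact this
  refine le_antisymm ?_ ?_
  · rintro _ ⟨h, hh, rfl⟩
    exact key γ h hh
  · intro h hh
    exact ⟨γ.symm h, key γ.symm h hh, γ.apply_symm_apply h⟩

end SettingModel

end Literature.AnabelianGeometry.EtaleTheta

end
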